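import Summits.Ventures.HSemireg.LineLawPrincipalGenus
import Summits.Ventures.HSemireg.LineLawCommonRoot
import HarnessLib

/-!
# Venture HSemireg — the LINE LAW's principal-genus capture for weights MEETING the discriminant (ramified part), kernel-checked
# (ENGINE-W code B, card LINE-LAW-B.md §7 Step 3 ∕ REF-W read ENGINEW-25 §A); continues `LineLawPrincipalGenus.lean`

HONEST FRAMING. Lean index of the computation cell `pub-hsemireg`, widening group ENGINE-W (code B, seat `engine-w-2`, gen 11). ARITHMETIC of
`ℤ[√m]` (Mathlib's `ℤ√m`) and of binary quadratic forms of discriminant `4m` through the tree's Literature (Cox Thm. 7.7 for `ℤ[√d]`,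
genus theory) exactly as in the parent file `LineLawPrincipalGenus.lean`, whose §2–§3 lemmas are imported, plus the Mathlib-only Step 1 file
`LineLawCommonRoot.lean`. Factorwise words, THEOREM CF⁶
and «reached weight lines» enter BY VALUE. No abelian variety, sheaf, `Ext` group or semiregularity map is constructed; nothing here says
that HC, HC_CM or HC_AV holds. Theorems only (0 `def`, 0 named fact, 0 `sorry`).

SOURCE (card `widen/ENGINE-W/out/probe4/LINE-LAW-B.md` §7, proof Step 3; `widen/REF-W/REFW-READ-ENGINEW-25.md` §A (2)): two primitive
ideals of `ℤ[√m]` of the same norm `n = n₀ n₁` (`n₀` prime to the discriminant, `n₁` the part at ramified primes) have the SAME ramified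
factor, so their classes differ by the classes of the prime-to-`4m` parts, which genus theory compares. KERNEL FORM (no invertibility of the
ramified factor is used): `(n, −A + l) = (n₀, −A + l)·(n₁, −A + l)` for coprime `n₀, n₁`; `(n₁, −A + l) = (n₁, −A' + l)` when
`n₁ ∣ A − A'`; the forms `(n₀, 2A, ·)`, `(n₀, 2A', ·)` represent the unit `n₀`, hence share a genus, hence (one class per genus, Cox 7.7 (ii))
`(u)(n₀, −A + l) = (v)(n₀, −A' + l)`; multiplying by the common factor and using `(n, −A' + l) = (x + y l)` gives `(u)(n, −A + l)` principal,
hence `(n, −A + l)` principal (cancellation in a domain), and the parent's §2 yields the primitive `z` with `N z = n`, `z ∣ A − l`.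

WHAT THE KERNEL HOLDS: `span_pair_congr`, `span_pair_mul_span_pair_coprime`, `mul_eq_root_of_bezout` (the root `A' = −x b` of `x + y l`),
`norm_mul_norm_of_dvd`, `exists_eq_span_singleton_of_span_singleton_mul` (cancellation), **`capture_ramified_of_forall_genus`**,
**`capture_ramified`** (class-number form `h(4m) = 2^{μ−1}`), **`capture_ramified_euler`** (unconditional for Euler's 65 convenient numbers),
`dvd_root_of_dvd_of_squarefree` ∕ `dvd_sub_roots_of_squarefree` (odd ramified primes divide every root: the agreement hypothesis is automatic
there); and the ASSEMBLED SUFFICIENCY of card §7 for weights prime to `4m`: **`lineLaw_sufficiency`** (class-number form) ∕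
**`lineLaw_sufficiency_euler`** (unconditional for Euler's 65 `k`) — Step 1 from `LineLawCommonRoot.lean` (`exists_common_root_int`) + the
parent's `capture`; `census_cell_sqrt_neg_five_nine` (a census cell's coprime weight).
NOT HERE: even `n` for `m ≡ 1 (4)` (§10's conductor-2 bookkeeping), real `m`, THEOREM CF⁶. Tier: kernel, extending the parent's
coprime-to-`4m` capture to all weights of the imaginary maximal-order case whose ramified parts agree with the given representation's root.
-/

open scoped nonZeroDivisors

namespace Summit.Ventures.HSemireg.LineLawRamifiedCapture

open Literature.NumberTheory.QuadraticFields (BinaryQuadraticForm.classNumber)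
open Literature.NumberTheory.QuadraticFields.BinaryQuadraticForm (assignedCharCount)
open Literature.NumberTheory.QuadraticFields.Quadratic
open Literature.NumberTheory.QuadraticFields.Quadratic.BinQF (mem_span_pair_iff)
open Literature.Computability.Cryptography.Hallgren2005.OrderCl (NegDiscr)
open Literature.Computability.Cryptography.Hallgren2005.FormComposition (one isPosPrim_one)
open Summit.Ventures.HSemireg.LineLawPrincipalGenus Summit.Ventures.HSemireg.LineLawCommonRoot

/-! ### The capture with a ramified part (card §7 Step 3, REF-W read §A) -/

/-- `𝔞_n(A)` depends only on `A mod n`: `n ∣ A − A' ⇒ (n, −A + l) = (n, −A' + l)`. [kernel] -/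
theorem span_pair_congr {m n A A' : ℤ} (h : n ∣ A - A') :
    Ideal.span {(n : ℤ√m), ⟨-A, 1⟩} = Ideal.span {(n : ℤ√m), ⟨-A', 1⟩} := by
  have key : ∀ {B B' : ℤ} (k : ℤ), B - B' = n * k →
      Ideal.span {(n : ℤ√m), ⟨-B, 1⟩} ≤ Ideal.span {(n : ℤ√m), ⟨-B', 1⟩} := by
    intro B B' k hk
    rw [Ideal.span_le]
    intro t ht
    simp only [Set.mem_insert_iff, Set.mem_singleton_iff] at ht
    rcases ht with rfl | rfl
    · exact Ideal.subset_span (by simp)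
    · rw [SetLike.mem_coe]
      refine Ideal.mem_span_pair.2 ⟨-(k : ℤ√m), 1, ?_⟩
      ext
      · simp [Zsqrtd.re_add, Zsqrtd.re_mul]; linarith
      · simp [Zsqrtd.im_add, Zsqrtd.im_mul]
  obtain ⟨k, hk⟩ := h
  exact le_antisymm (key k hk) (key (-k) (by linarith))

/-- **Product formula for coprime norms**: `(n₀, −A + l)·(n₁, −A + l) = (n₀ n₁, −A + l)` when `gcd(n₀, n₁) = 1` (no hypothesis on
`A`; `−A + l = u n₀ (−A + l) + v n₁ (−A + l)`). [kernel] -/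
theorem span_pair_mul_span_pair_coprime {m n₀ n₁ A : ℤ} (h : IsCoprime n₀ n₁) :
    Ideal.span {(n₀ : ℤ√m), ⟨-A, 1⟩} * Ideal.span {(n₁ : ℤ√m), ⟨-A, 1⟩} =
      Ideal.span {((n₀ * n₁ : ℤ) : ℤ√m), ⟨-A, 1⟩} := by
  obtain ⟨u, v, huv⟩ := h
  apply le_antisymm
  · rw [Ideal.mul_le]
    intro a ha b hb
    obtain ⟨a1, a2, rfl⟩ := Ideal.mem_span_pair.1 ha
    obtain ⟨b1, b2, rfl⟩ := Ideal.mem_span_pair.1 hb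
    refine Ideal.mem_span_pair.2
      ⟨a1 * b1, a1 * (n₀ : ℤ√m) * b2 + a2 * (b1 * (n₁ : ℤ√m) + b2 * ⟨-A, 1⟩), ?_⟩
    push_cast
    ring
  · rw [Ideal.span_le]
    intro t ht
    simp only [Set.mem_insert_iff, Set.mem_singleton_iff] at ht
    rcases ht with rfl | rfl
    · rw [SetLike.mem_coe, Int.cast_mul]
      exact Ideal.mul_mem_mul (Ideal.subset_span (by simp)) (Ideal.subset_span (by simp))
    · rw [SetLike.mem_coe]
      have h1 : (u : ℤ√m) * (n₀ : ℤ√m) + (v : ℤ√m) * (n₁ : ℤ√m) = 1 := by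
        ext
        · simp [Zsqrtd.re_add, Zsqrtd.re_mul]; linarith
        · simp [Zsqrtd.im_add, Zsqrtd.im_mul]
      have e : (⟨-A, 1⟩ : ℤ√m) = (u : ℤ√m) * ((n₀ : ℤ√m) * ⟨-A, 1⟩) + (v : ℤ√m) * (⟨-A, 1⟩ * (n₁ : ℤ√m)) := by
        linear_combination (-(⟨-A, 1⟩ : ℤ√m)) * h1
      have hmem : (u : ℤ√m) * ((n₀ : ℤ√m) * ⟨-A, 1⟩) + (v : ℤ√m) * (⟨-A, 1⟩ * (n₁ : ℤ√m)) ∈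
          Ideal.span {(n₀ : ℤ√m), ⟨-A, 1⟩} * Ideal.span {(n₁ : ℤ√m), ⟨-A, 1⟩} :=
        Ideal.add_mem _
          (Ideal.mul_mem_left _ _ (Ideal.mul_mem_mul (Ideal.subset_span (by simp)) (Ideal.subset_span (by simp))))
          (Ideal.mul_mem_left _ _ (Ideal.mul_mem_mul (Ideal.subset_span (by simp)) (Ideal.subset_span (by simp))))
      rw [← e] at hmem
      exact hmem

/-- **The root attached to a primitive representation**: if `a·(x² − m y²) + b·y = 1` then `x + y l` divides `A' − l` with `A' = −x b`,
explicitly `(x + y l)·((m y a − b) − x a·l) = −x b − l`. [kernel] -/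
theorem mul_eq_root_of_bezout {m x y a b : ℤ} (h : a * (x ^ 2 - m * y ^ 2) + b * y = 1) :
    (⟨x, y⟩ : ℤ√m) * ⟨m * y * a - b, -(x * a)⟩ = ⟨-(x * b), -1⟩ := by
  ext
  · simp [Zsqrtd.re_mul]; ring
  · simp [Zsqrtd.im_mul]; linear_combination (-1 : ℤ) * h

/-- Norms along `z·w = A − l`: `N z · N w = A² − m`. [kernel] -/
theorem norm_mul_norm_of_dvd {m A : ℤ} {z w : ℤ√m} (h : z * w = ⟨A, -1⟩) : z.norm * w.norm = A ^ 2 - m := by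
  have := congrArg Zsqrtd.norm h
  rw [Zsqrtd.norm_mul] at this
  rw [this, Zsqrtd.norm_def]
  ring

/-- **Cancellation**: in a domain, `(x)·I = (t)` with `x ≠ 0` forces `I` to be principal (generated by the `i₀ ∈ I` with `x i₀ = t`). [kernel] -/
theorem exists_eq_span_singleton_of_span_singleton_mul {R : Type*} [CommRing R] [IsDomain R] {x t : R} {I : Ideal R}
    (hx : x ≠ 0) (h : Ideal.span {x} * I = Ideal.span {t}) : ∃ g : R, I = Ideal.span {g} := by
  have ht : t ∈ Ideal.span {x} * I := h ▸ Ideal.mem_span_singleton_self t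
  obtain ⟨g, hgI, hgt⟩ := Ideal.mem_span_singleton_mul.1 ht
  refine ⟨g, le_antisymm ?_ ((Ideal.span_singleton_le_iff_mem _).2 hgI)⟩
  intro i hi
  have hxi : x * i ∈ Ideal.span {t} := h ▸ Ideal.mul_mem_mul (Ideal.mem_span_singleton_self x) hi
  obtain ⟨s, hs⟩ := Ideal.mem_span_singleton.1 hxi
  rw [← hgt, mul_assoc] at hs
  exact Ideal.mem_span_singleton.2 ⟨s, mul_left_cancel₀ hx hs⟩

/-- **PRINCIPAL-GENUS CAPTURE WITH A RAMIFIED PART** (card §7 Step 3 as REF-W read §A re-derives it: strip the part of the norm that is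
not prime to the discriminant). `m < 0`, one class per genus for `4m` (on forms). Let `n = n₀ n₁` with `n₀ > 0` prime to `4m` and to
`n₁ > 0`; let `x + y l` (norm `n`) divide `A' − l`, and let `A` be another root with `n ∣ A² − m` (`A² − n c = m`) such that the
`n₁`-parts AGREE: `n₁ ∣ A − A'` (automatic at ramified odd primes, which divide every root — `dvd_root_of_dvd_of_squarefree` — and at
`2 ∥ n` for `m ≡ 3 (4)`, where all roots are odd). Then a primitive `z` with `N z = n` divides `A − l`.
Route: `(n, −A + l) = (n₀, −A + l)·(n₁, −A + l)` and `(n, −A' + l) = (n₀, −A' + l)·(n₁, −A' + l) = (x + y l)` with EQUAL second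
factors; the first factors are the ideals of the forms `(n₀, 2A, c n₁)`, `(n₀, 2A', c' n₁)`, both representing the unit `n₀`, hence of
the same genus, hence (one class per genus + Cox 7.7 (ii), tree `toClass_eq_toClass_iff`) `(u)·(n₀, −A + l) = (v)·(n₀, −A' + l)` for
some `u, v ≠ 0`; multiplying by the common factor, `(u)·(n, −A + l) = (v·(x + y l))` is principal, so `(n, −A + l)` is (cancellation),
and §2 finishes. No invertibility of the ramified factor is used. [kernel] -/
theorem capture_ramified_of_forall_genus {m : ℤ} (hm : m < 0)
    (H : ∀ f g : BinQF, f.IsPosPrim (4 * m) → g.IsPosPrim (4 * m) → f.genus (4 * m) = g.genus (4 * m) → f.ProperEquiv g)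
    {n₀ n₁ c A A' x y : ℤ} {w' : ℤ√m} (hn₀ : 0 < n₀) (hn₁ : 0 < n₁) (hc : A ^ 2 - n₀ * n₁ * c = m)
    (hcop : IsCoprime n₀ (4 * m)) (hcop' : IsCoprime n₀ n₁)
    (hz' : (⟨x, y⟩ : ℤ√m) * w' = ⟨A', -1⟩) (hxy : x ^ 2 - m * y ^ 2 = n₀ * n₁) (hAA' : n₁ ∣ A - A') :
    ∃ z : ℤ√m, z.norm = n₀ * n₁ ∧ z ∣ (⟨A, -1⟩ : ℤ√m) ∧ IsCoprime z.re z.im := by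
  haveI : IsDomain (ℤ√m) := Zsqrtd.isDomain_of_neg hm
  have hD : 4 * m < 0 := by omega
  have hn : 0 < n₀ * n₁ := mul_pos hn₀ hn₁
  have hnorm' : (⟨x, y⟩ : ℤ√m).norm = n₀ * n₁ := by rw [Zsqrtd.norm_def, ← hxy]; ring
  have hc' : A' ^ 2 - n₀ * n₁ * w'.norm = m := by
    have := norm_mul_norm_of_dvd hz'
    rw [hnorm'] at this
    linear_combination (-1 : ℤ) * this
  -- the prime-to-`4m` factors as forms of discriminant `4m`, both representing the unit `n₀`
  have hf₀ : (⟨n₀, 2 * A, c * n₁⟩ : BinQF).IsPosPrim (4 * m) := lineForm_isPosPrim hn₀ (by linear_combination hc) hcop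
  have hf₀' : (⟨n₀, 2 * A', w'.norm * n₁⟩ : BinQF).IsPosPrim (4 * m) :=
    lineForm_isPosPrim hn₀ (by linear_combination hc') hcop
  have hcoe : ((unitOfIsCoprime hcop : (ZMod (4 * m).natAbs)ˣ) : ZMod (4 * m).natAbs) = (n₀ : ZMod (4 * m).natAbs) := rfl
  have hgen : (⟨n₀, 2 * A, c * n₁⟩ : BinQF).genus (4 * m) = (⟨n₀, 2 * A', w'.norm * n₁⟩ : BinQF).genus (4 * m) := by
    rw [BinQF.genus_eq_mk hD hf₀ (BinQF.mem_valueSet_of_eq_a hcoe.symm),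
      BinQF.genus_eq_mk hD hf₀' (BinQF.mem_valueSet_of_eq_a hcoe.symm)]
  have hcl := BinQF.toClass_eq_of_properEquiv hm hf₀ (H _ _ hf₀ hf₀' hgen)
  rw [BinQF.toClass_eq_toClass_iff (BinQF.isUnit_fracIdeal_of_isPosPrim hf₀)
    (BinQF.isUnit_fracIdeal_of_isPosPrim hf₀'), ideal_lineForm, ideal_lineForm] at hcl
  obtain ⟨u, v, hu, -, huv⟩ := hcl
  -- multiply by the common ramified factor
  have hR : Ideal.span {(n₁ : ℤ√m), ⟨-A, 1⟩} = Ideal.span {(n₁ : ℤ√m), ⟨-A', 1⟩} := span_pair_congr hAA'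
  have hz'span : Ideal.span {((n₀ * n₁ : ℤ) : ℤ√m), ⟨-A', 1⟩} = Ideal.span {(⟨x, y⟩ : ℤ√m)} :=
    span_eq_of_dvd_of_norm (c := w'.norm) (by linear_combination hc') ⟨w', hz'.symm⟩ (Or.inl hnorm')
  have key : Ideal.span {u} * Ideal.span {((n₀ * n₁ : ℤ) : ℤ√m), ⟨-A, 1⟩} = Ideal.span {v * ⟨x, y⟩} := by
    rw [← span_pair_mul_span_pair_coprime hcop', ← mul_assoc, huv, mul_assoc, hR,
      span_pair_mul_span_pair_coprime hcop', hz'span, Ideal.span_singleton_mul_span_singleton]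
  obtain ⟨g, hg⟩ := exists_eq_span_singleton_of_span_singleton_mul hu key
  obtain ⟨hdvd, hnorm⟩ := dvd_and_norm_of_span_eq hn.ne' hc hg
  have h0 := Zsqrtd.norm_nonneg hm.le g
  refine ⟨g, ?_, hdvd, ?_⟩
  · rcases hnorm with h | h
    · exact h
    · omega
  · obtain ⟨w, hw⟩ := hdvd
    exact isCoprime_of_dvd hw.symm

/-- The same under the printed class-number criterion `h(4m) = 2^{μ−1}` (Cox Thm. 3.22 (v)). [kernel] -/
theorem capture_ramified {m : ℤ} (hm : m < 0)
    (hh : BinaryQuadraticForm.classNumber (4 * m) = 2 ^ (assignedCharCount (4 * m) - 1))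
    {n₀ n₁ c A A' x y : ℤ} {w' : ℤ√m} (hn₀ : 0 < n₀) (hn₁ : 0 < n₁) (hc : A ^ 2 - n₀ * n₁ * c = m)
    (hcop : IsCoprime n₀ (4 * m)) (hcop' : IsCoprime n₀ n₁)
    (hz' : (⟨x, y⟩ : ℤ√m) * w' = ⟨A', -1⟩) (hxy : x ^ 2 - m * y ^ 2 = n₀ * n₁) (hAA' : n₁ ∣ A - A') :
    ∃ z : ℤ√m, z.norm = n₀ * n₁ ∧ z ∣ (⟨A, -1⟩ : ℤ√m) ∧ IsCoprime z.re z.im := by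
  let Δ : NegDiscr := ⟨4 * m, by omega⟩
  have hD4 : Δ.D % 4 = 0 ∨ Δ.D % 4 = 1 := Or.inl (show (4 * m) % 4 = 0 by omega)
  have hsq := (forall_sq_eq_one_iff_classNumber_eq Δ hD4).2 hh
  exact capture_ramified_of_forall_genus hm ((forall_genus_eq_imp_properEquiv_iff_forall_sq_eq_one Δ hD4).2 hsq)
    hn₀ hn₁ hc hcop hcop' hz' hxy hAA'

/-- The same for Euler's 65 convenient numbers `k` (`m = −k`), unconditionally. [kernel] -/
theorem capture_ramified_euler {k : ℕ} (hk : k ∈ eulerConvenientNumbers)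
    {n₀ n₁ c A A' x y : ℤ} {w' : ℤ√(-(k : ℤ))} (hn₀ : 0 < n₀) (hn₁ : 0 < n₁) (hc : A ^ 2 - n₀ * n₁ * c = -(k : ℤ))
    (hcop : IsCoprime n₀ (4 * (k : ℤ))) (hcop' : IsCoprime n₀ n₁)
    (hz' : (⟨x, y⟩ : ℤ√(-(k : ℤ))) * w' = ⟨A', -1⟩) (hxy : x ^ 2 + (k : ℤ) * y ^ 2 = n₀ * n₁) (hAA' : n₁ ∣ A - A') :
    ∃ z : ℤ√(-(k : ℤ)), z.norm = n₀ * n₁ ∧ z ∣ (⟨A, -1⟩ : ℤ√(-(k : ℤ))) ∧ IsCoprime z.re z.im := by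
  obtain ⟨hk0, h⟩ := euler_forall_ambiguous k hk
  rw [show (-4 * (k : ℤ)) = 4 * (-(k : ℤ)) by ring] at h
  let Δ : NegDiscr := ⟨4 * (-(k : ℤ)), by omega⟩
  have hD4 : Δ.D % 4 = 0 ∨ Δ.D % 4 = 1 := Or.inl (show (4 * (-(k : ℤ))) % 4 = 0 by omega)
  have hsq := (forall_ambiguous_iff_forall_sq_eq_one Δ hD4).1 h
  have hcop1 : IsCoprime n₀ (4 * (-(k : ℤ))) := by
    rw [show 4 * (-(k : ℤ)) = -(4 * (k : ℤ)) by ring]; exact hcop.neg_right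
  exact capture_ramified_of_forall_genus (by omega) ((forall_genus_eq_imp_properEquiv_iff_forall_sq_eq_one Δ hD4).2 hsq)
    hn₀ hn₁ hc hcop1 hcop' hz' (by linear_combination hxy) hAA'

/-- **Ramified odd primes see every root**: if `n₁ ∣ m` is squarefree and `n₁ ∣ A² − m`, then `n₁ ∣ A`; hence two roots `A, A'` of `m`
modulo multiples of `n₁` always satisfy `n₁ ∣ A − A'` — the hypothesis `hAA'` of `capture_ramified` is automatic at the odd ramified
part. [kernel] -/
theorem dvd_root_of_dvd_of_squarefree {m n₁ A : ℤ} (hsq : Squarefree n₁) (hm : n₁ ∣ m) (hA : n₁ ∣ A ^ 2 - m) : n₁ ∣ A := by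
  have h2 : n₁ ∣ A ^ 2 := by
    have e : A ^ 2 = (A ^ 2 - m) + m := by ring
    rw [e]; exact dvd_add hA hm
  exact (hsq.dvd_pow_iff_dvd two_ne_zero).1 h2

/-- … so `n₁ ∣ A − A'` for any two such roots. [kernel] -/
theorem dvd_sub_roots_of_squarefree {m n₁ A A' : ℤ} (hsq : Squarefree n₁) (hm : n₁ ∣ m) (hA : n₁ ∣ A ^ 2 - m)
    (hA' : n₁ ∣ A' ^ 2 - m) : n₁ ∣ A - A' :=
  dvd_sub (dvd_root_of_dvd_of_squarefree hsq hm hA) (dvd_root_of_dvd_of_squarefree hsq hm hA')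

/-! ### The LINE LAW's sufficiency assembled (card §7 THEOREM, coprime-to-`4m` weights): Step 1 + capture -/

/-- **LINE LAW §7, SUFFICIENCY, KERNEL (imaginary one-class-per-genus, weights prime to `4m`)**: let `m < 0` with
`h(4m) = 2^{μ−1}`; let `ns` be a finite list of positive integers (the `T∕c_j` of a weight line), each prime to `4m` and each the norm of a
PRIMITIVE element `x + y l` of `ℤ[√m]`. Then there is ONE integer `A` such that every `n` in the list is the norm of a primitive `z_n ∈ ℤ[√m]`
dividing `A − l` — THEOREM CF⁶'s factorwise criterion holds: the line is reached. (Step 1 `exists_common_root_int` — the common root exists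
because each `n` carries one and roots glue along `lcm` — then `capture` for each `n` at that `A`.) [kernel] -/
theorem lineLaw_sufficiency {m : ℤ} (hm : m < 0)
    (hh : BinaryQuadraticForm.classNumber (4 * m) = 2 ^ (assignedCharCount (4 * m) - 1)) (ns : List ℤ)
    (h : ∀ n ∈ ns, 0 < n ∧ IsCoprime n (4 * m) ∧ ∃ x y : ℤ, IsCoprime x y ∧ x ^ 2 - m * y ^ 2 = n) :
    ∃ A : ℤ, ∀ n ∈ ns, ∃ z : ℤ√m, z.norm = n ∧ z ∣ (⟨A, -1⟩ : ℤ√m) ∧ IsCoprime z.re z.im := by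
  have h1 : ∀ n ∈ ns, 0 < n ∧ ∃ A : ℤ, n ∣ A ^ 2 - m := by
    intro n hn
    obtain ⟨hn0, -, x, y, hxy, hrep⟩ := h n hn
    obtain ⟨A, hA⟩ := exists_root_of_primitive_rep m hxy
    exact ⟨hn0, A, by rwa [hrep] at hA⟩
  obtain ⟨A, hA⟩ := exists_common_root_int ns h1
  refine ⟨A, fun n hn => ?_⟩
  obtain ⟨hn0, hcop, x, y, -, hrep⟩ := h n hn
  obtain ⟨c, hc⟩ := hA n hn
  exact capture hm hh (c := c) (A := A) hn0 (by linear_combination hc) hcop hrep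

/-- **The same, UNCONDITIONAL, for Euler's 65 convenient numbers** (`m = −k`; in particular every imaginary one-class-per-genus node field
of the census): weights `n` prime to `4k`, each `n = x² + k y²` with `gcd(x, y) = 1` ⇒ one `A` and primitive `z_n` of norm `n` dividing
`A − √−k` for all of them. [kernel] -/
theorem lineLaw_sufficiency_euler {k : ℕ} (hk : k ∈ eulerConvenientNumbers) (ns : List ℤ)
    (h : ∀ n ∈ ns, 0 < n ∧ IsCoprime n (4 * (k : ℤ)) ∧ ∃ x y : ℤ, IsCoprime x y ∧ x ^ 2 + (k : ℤ) * y ^ 2 = n) :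
    ∃ A : ℤ, ∀ n ∈ ns, ∃ z : ℤ√(-(k : ℤ)), z.norm = n ∧ z ∣ (⟨A, -1⟩ : ℤ√(-(k : ℤ))) ∧ IsCoprime z.re z.im := by
  have h1 : ∀ n ∈ ns, 0 < n ∧ ∃ A : ℤ, n ∣ A ^ 2 - (-(k : ℤ)) := by
    intro n hn
    obtain ⟨hn0, -, x, y, hxy, hrep⟩ := h n hn
    obtain ⟨A, hA⟩ := exists_root_of_primitive_rep (-(k : ℤ)) hxy
    have e : x ^ 2 - (-(k : ℤ)) * y ^ 2 = n := by linear_combination hrep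
    exact ⟨hn0, A, by rwa [e] at hA⟩
  obtain ⟨A, hA⟩ := exists_common_root_int ns h1
  refine ⟨A, fun n hn => ?_⟩
  obtain ⟨hn0, hcop, x, y, -, hrep⟩ := h n hn
  obtain ⟨c, hc⟩ := hA n hn
  exact capture_euler hk (c := c) (A := A) hn0 (by linear_combination hc) hcop hrep

/-- **Worked census cell** (card §3, `m = −5`, weights `{1, 6, 9}` ⊂ line at `T = 54`: norms `54, 9, 6`; OBSERVATION 16-4's triangle
`{1,6,9}`). The coprime-to-`20` member `9 = 2² + 5·1²` is captured by the kernel theorem at ANY root; the members `54, 6` meet the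
discriminant and are the business of `capture_ramified`. Here: the unconditional statement for the weight `9`. [kernel] -/
theorem census_cell_sqrt_neg_five_nine {A c : ℤ} (hc : A ^ 2 - 9 * c = -5) :
    ∃ z : ℤ√(-5), z.norm = 9 ∧ z ∣ (⟨A, -1⟩ : ℤ√(-5)) ∧ IsCoprime z.re z.im :=
  capture_sqrt_neg_five (x := 2) (y := 1) (by norm_num) hc (by norm_num) (by norm_num)

end Summit.Ventures.HSemireg.LineLawRamifiedCapture
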